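import Literature.Computability.AlgebraicComplexity.DegenerationSpectralMonotone
import Literature.Computability.AlgebraicComplexity.XyzCubeFlattening
import Literature.Computability.AlgebraicComplexity.RelativeExponent
import HarnessLib

/-!
# Bond dimension two on the triangle: `T_{skewcw,2} ≤ ⟨2,2,2⟩` and `⟨2,2,2⟩ ⊵ T_{cw,2}`

`Summit.MatrixMultiplication.MatrixMultiplication.Theorems` — solo programme `solo-MatrixMultiplication-blind`.

The two smallest Coppersmith–Winograd-type tensors, each of which would give `ω = 2` if its asymptotic
rank were `3` (CGLV 2022), are *presented by the `2 × 2` matrix multiplication tensor*, i.e. by the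
triangular tensor network with all three bond dimensions equal to `2`:

* `matMulTensor_two_restrictsTo_skewCwTensor_one` — **`⟨2,2,2⟩ ≥ T_{skewcw,2}`** (a restriction, with
  integer matrices): on `𝔰𝔩₂ ⊂ Mat₂` with basis `(H, E, F)` one has `tr(σ_i σ_j σ_k) = ε_{ijk}`, and
  `T_{skewcw,2}` is the Levi-Civita tensor up to the signed permutation of CGLV §3.2.
* `matMulTensor_two_restrictsTo_cwConeTensor` — **`⟨2,2,2⟩ ≥ e₀^{⊗3} + T_{cw,2}`**: on the commutative
  plane-plus-identity `span(1, Z, X) ⊂ Mat₂` (`Z = diag(1,-1)`, `X = antidiag(1,1)`) one has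
  `½ tr(τ_i τ_j τ_k) = [i = j = k = 0] + (T_{cw,2})_{ijk}`.
* `algDegeneratesTo_initialPart` — a toric initial part of a tensor is a degeneration of it (diagonal
  substitution `ε^{w}`; BCS §15.4), stated for `AlgDegeneratesTo`; hence
  `matMulTensor_two_algDegeneratesTo_cwTensor_two` — **`⟨2,2,2⟩ ⊵ T_{cw,2}`** (weights `(2,1,1)` on each
  factor cut `e₀^{⊗3} + T_{cw,2}` down to its weight-`4` part `T_{cw,2}`), and
  `matMulTensor_two_algDegeneratesTo_xyzTensor` — `⟨2,2,2⟩ ⊵ X` (the square-free monomial `xyz`).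
* Relative-exponent form (CVZ 2021, Def. 2): `relativeExponent ⟨2,2,2⟩ T_{skewcw,2} ≤ 1`, i.e. the `N`-th
  Kronecker power of `T_{skewcw,2}` is a restriction of `⟨2^N, 2^N, 2^N⟩` for every `N`.

Context ("door R" of the programme): for `T ∈ {T_{cw,2}, T_{skewcw,2}}` put
`c(T) = lim_N N⁻¹ log₃ (min {a : T^{⊠N} ⊴ ⟨a,a,a⟩})`.  Flattenings give `c(T) ≥ 1/2`, the results here give
`c(T) ≤ log₃ 2`, and `log₃ R̃(T) / ω ≤ c(T) ≤ log₃ R̃(T) / 2`; so `c(T) = 1/2` would upgrade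
"`R̃(T) = 3 ⟹ ω = 2`" to an equivalence and would bound `R̃(T) ≤ 3^{ω/2}`.
-/

open scoped BigOperators Polynomial

open Literature.Computability.AlgebraicComplexity

set_option linter.dupNamespace false

namespace Summit.MatrixMultiplication.MatrixMultiplication.Theorems

/-! ## Sums against `⟨2,2,2⟩` -/

/-- A triple sum against `⟨2,2,2⟩` is the sum over its eight entries:
`∑_{a,b,c} f(a,b,c) ⟨2,2,2⟩_{abc} = ∑_{κ,μ,ν} f((κ,ν),(κ,μ),(μ,ν))` ("`tr(P^T Q R)`"). [cite: Blaser2013, §5] -/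
theorem sum_mul_matMulTensor_two_two_two {R : Type*} [CommSemiring R]
    (f : Fin 2 × Fin 2 → Fin 2 × Fin 2 → Fin 2 × Fin 2 → R) :
    ∑ a, ∑ b, ∑ c, f a b c * matMulTensor R 2 2 2 a b c =
      ∑ κ : Fin 2, ∑ μ : Fin 2, ∑ ν : Fin 2, f (κ, ν) (κ, μ) (μ, ν) := by
  simp only [Fintype.sum_prod_type, Fin.sum_univ_two, matMulTensor]
  simp
  try ring

/-! ## `⟨2,2,2⟩ ≥ T_{skewcw,2}` via `𝔰𝔩₂` -/

/-- First factor: `P_0 = H`, `P_1 = Eᵀ = F`, `P_2 = Fᵀ = E` (as `2 × 2` tables; the pairing is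
`tr(Pᵀ Q R)`). [new] -/
def skewPresA : Fin 3 → Fin 2 → Fin 2 → ℤ :=
  ![![![1, 0], ![0, -1]], ![![0, 0], ![1, 0]], ![![0, 1], ![0, 0]]]

/-- Second factor: `Q_0 = -H`, `Q_1 = E`, `Q_2 = F` (the sign is CGLV's `b̃₀ = -b₀`). [new] -/
def skewPresB : Fin 3 → Fin 2 → Fin 2 → ℤ :=
  ![![![-1, 0], ![0, 1]], ![![0, 1], ![0, 0]], ![![0, 0], ![1, 0]]]

/-- Third factor: `R_0 = H`, `R_1 = F`, `R_2 = -E` (CGLV's `c̃₁ = c₂`, `c̃₂ = -c₁`). [new] -/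
def skewPresC : Fin 3 → Fin 2 → Fin 2 → ℤ :=
  ![![![1, 0], ![0, -1]], ![![0, 0], ![1, 0]], ![![0, -1], ![0, 0]]]

/-- **`⟨2,2,2⟩ ≥ T_{skewcw,2}`**: the skew little Coppersmith–Winograd tensor `T_{skewcw,2} ≅ det₃|_{Λ³}`
is a restriction of the `2 × 2` matrix multiplication tensor — `(T_{skewcw,2})_{ijk} = tr(P_iᵀ Q_j R_k)` for
the `𝔰𝔩₂`-matrices above (`tr(HEF) = 1`, `tr` vanishes on words with a repeated letter).  Equivalently:
`T_{skewcw,2}` is a triangular tensor network state with bond dimensions `(2,2,2)`. [new] -/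
theorem matMulTensor_two_restrictsTo_skewCwTensor_one :
    TensorRestrictsTo (matMulTensor ℂ 2 2 2) (skewCwTensor ℂ 1) := by
  refine ⟨fun i a => (skewPresA i a.1 a.2 : ℂ), fun j b => (skewPresB j b.1 b.2 : ℂ),
    fun k c => (skewPresC k c.1 c.2 : ℂ), fun i j k => ?_⟩
  dsimp only
  rw [sum_mul_matMulTensor_two_two_two (R := ℂ)
    (fun a b c => (skewPresA i a.1 a.2 : ℂ) * (skewPresB j b.1 b.2 : ℂ) * (skewPresC k c.1 c.2 : ℂ))]
  fin_cases i <;> fin_cases j <;> fin_cases k <;>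
    simp [Fin.sum_univ_two, skewPresA, skewPresB, skewPresC, skewCwTensor]

/-- Hence every Kronecker power: `⟨2,2,2⟩^{⊠N} ≥ T_{skewcw,2}^{⊠N}` (`⟨2,2,2⟩^{⊠N} ≅ ⟨2^N,2^N,2^N⟩`).
[new] -/
theorem matMulTensor_two_pow_restrictsTo_skewCwTensor_one_pow (N : ℕ) :
    TensorRestrictsTo (kroneckerPow (matMulTensor ℂ 2 2 2) N) (kroneckerPow (skewCwTensor ℂ 1) N) :=
  matMulTensor_two_restrictsTo_skewCwTensor_one.kroneckerPow N

/-- In the language of CVZ 2021 (Def. 2): the relative exponent `ω(⟨2,2,2⟩, T_{skewcw,2})` is at most `1`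
(one copy of the bond-dimension-`2` triangle per copy of `T_{skewcw,2}`).  The flattening lower bound is
`log₄ 3 ≈ 0.79`. [new] -/
theorem relativeExponent_matMulTensor_two_skewCwTensor_one_le_one :
    relativeExponent (matMulTensor ℂ 2 2 2) (skewCwTensor ℂ 1) ≤ 1 := by
  have h := relativeExponent_le_div (t := matMulTensor ℂ 2 2 2) (s := skewCwTensor ℂ 1) (n := 0)
    (m := 1) (matMulTensor_two_pow_restrictsTo_skewCwTensor_one_pow 1)
  simpa using h

/-! ## `⟨2,2,2⟩ ≥ e₀^{⊗3} + T_{cw,2}` via the plane `span(1, Z, X)` -/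

/-- The cone over the little Coppersmith–Winograd tensor: `e₀ ⊗ e₀ ⊗ e₀ + T_{cw,2}` (the symmetric tensor
of the cubic `x₀³ + 3 x₀ (x₁² + x₂²)`, up to the factor `3`). [new] -/
def cwConeTensor (K : Type*) [CommSemiring K] : Fin 3 → Fin 3 → Fin 3 → K :=
  fun i j k => if i = 0 ∧ j = 0 ∧ k = 0 then 1 else cwTensor K 2 i j k

/-- The commuting `2 × 2` matrices `τ_0 = 1`, `τ_1 = Z = diag(1,-1)`, `τ_2 = X = antidiag(1,1)`
(all symmetric, `Z² = X² = 1`, `ZX = -XZ` traceless). [new] -/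
def cwPresTau : Fin 3 → Fin 2 → Fin 2 → ℤ :=
  ![![![1, 0], ![0, 1]], ![![1, 0], ![0, -1]], ![![0, 1], ![1, 0]]]

/-- **`⟨2,2,2⟩ ≥ e₀^{⊗3} + T_{cw,2}`**: `½ tr(τ_i τ_j τ_k) = (e₀^{⊗3} + T_{cw,2})_{ijk}` — the trace of a
word in `1, Z, X` is `2` if the letters pair off (`111`, `1ZZ`, `1XX` and permutations) and `0` otherwise.
[new] -/
theorem matMulTensor_two_restrictsTo_cwConeTensor :
    TensorRestrictsTo (matMulTensor ℂ 2 2 2) (cwConeTensor ℂ) := by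
  refine ⟨fun i a => (1 / 2 : ℂ) * (cwPresTau i a.1 a.2 : ℂ), fun j b => (cwPresTau j b.1 b.2 : ℂ),
    fun k c => (cwPresTau k c.1 c.2 : ℂ), fun i j k => ?_⟩
  dsimp only
  rw [sum_mul_matMulTensor_two_two_two (R := ℂ)
    (fun a b c => (1 / 2 : ℂ) * (cwPresTau i a.1 a.2 : ℂ) * (cwPresTau j b.1 b.2 : ℂ) *
      (cwPresTau k c.1 c.2 : ℂ))]
  fin_cases i <;> fin_cases j <;> fin_cases k <;>
    simp [Fin.sum_univ_two, cwPresTau, cwConeTensor, cwTensor] <;> norm_num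

/-! ## Toric initial parts are degenerations -/

/-- **Toric degeneration** (BCS §15.4, in the `K[ε]`-coordinates of `IsApproxRestriction`): if `t`
vanishes in total weight `< h` for weights `w₁, w₂, w₃` on the three index sets, then the diagonal
substitution `e_a ↦ ε^{w₁ a} e_a`, `e_b ↦ ε^{w₂ b} e_b`, `e_c ↦ ε^{w₃ c} e_c` exhibits the weight-`h` part
`in_h t = [w₁ a + w₂ b + w₃ c = h] · t` as a degeneration of order `h` of `t`. [new] -/
theorem isApproxRestriction_initialPart {ι κ μ : Type} [Fintype ι] [Fintype κ] [Fintype μ]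
    [DecidableEq ι] [DecidableEq κ] [DecidableEq μ] {K : Type*} [CommSemiring K] (t : ι → κ → μ → K)
    (w₁ : ι → ℕ) (w₂ : κ → ℕ) (w₃ : μ → ℕ) (h : ℕ)
    (hlow : ∀ a b c, w₁ a + w₂ b + w₃ c < h → t a b c = 0) :
    IsApproxRestriction h t (fun a b c => if w₁ a + w₂ b + w₃ c = h then t a b c else 0)
      (fun a' a => if a = a' then Polynomial.X ^ (w₁ a) else 0)
      (fun b' b => if b = b' then Polynomial.X ^ (w₂ b) else 0)
      (fun c' c => if c = c' then Polynomial.X ^ (w₃ c) else 0) := by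
  intro a' b' c' j hj
  dsimp only
  rw [Finset.sum_eq_single a' (fun a _ ha => by simp [ha]) (by simp),
    Finset.sum_eq_single b' (fun b _ hb => by simp [hb]) (by simp),
    Finset.sum_eq_single c' (fun c _ hc => by simp [hc]) (by simp)]
  simp only [if_true]
  rw [← pow_add, ← pow_add, Polynomial.coeff_X_pow_mul', Polynomial.coeff_C]
  by_cases hw : w₁ a' + w₂ b' + w₃ c' = h
  · rw [hw]
    by_cases hjh : j = h
    · subst hjh
      simp
    · have hlt : j < h := lt_of_le_of_ne hj hjh
      rw [if_neg (not_le.2 hlt), if_neg hjh]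
  · rw [if_neg hw]
    by_cases hle : w₁ a' + w₂ b' + w₃ c' ≤ j
    · rw [if_pos hle]
      by_cases hz : j - (w₁ a' + w₂ b' + w₃ c') = 0
      · -- then `w = j ≤ h` and `w ≠ h`, so `w < h` and `t = 0`
        have hwj : w₁ a' + w₂ b' + w₃ c' = j := by omega
        have hwlt : w₁ a' + w₂ b' + w₃ c' < h := by omega
        rw [if_pos hz, hlow _ _ _ hwlt]
        split_ifs <;> rfl
      · rw [if_neg hz]
        split_ifs <;> rfl
    · rw [if_neg hle]
      split_ifs <;> rfl

/-- A toric initial part of `t` is a degeneration of `t`: `t ⊵ in_h t`. [new] -/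
theorem algDegeneratesTo_initialPart {ι κ μ : Type} [Fintype ι] [Fintype κ] [Fintype μ]
    [DecidableEq ι] [DecidableEq κ] [DecidableEq μ] {K : Type*} [CommSemiring K] (t : ι → κ → μ → K)
    (w₁ : ι → ℕ) (w₂ : κ → ℕ) (w₃ : μ → ℕ) (h : ℕ)
    (hlow : ∀ a b c, w₁ a + w₂ b + w₃ c < h → t a b c = 0) :
    AlgDegeneratesTo t (fun a b c => if w₁ a + w₂ b + w₃ c = h then t a b c else 0) :=
  ⟨h, _, _, _, isApproxRestriction_initialPart t w₁ w₂ w₃ h hlow⟩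

/-! ## `⟨2,2,2⟩ ⊵ T_{cw,2}` and `⟨2,2,2⟩ ⊵ X` -/

/-- The weight `(2,1,1)` on `{0,1,2}`. [new] -/
def cwConeWt : Fin 3 → ℕ := ![2, 1, 1]

/-- `e₀^{⊗3} + T_{cw,2}` has no entry of total `(2,1,1)`-weight `< 4` … [new] -/
theorem cwConeTensor_low (K : Type*) [CommSemiring K] :
    ∀ a b c : Fin 3, cwConeWt a + cwConeWt b + cwConeWt c < 4 → cwConeTensor K a b c = 0 := by
  intro a b c
  fin_cases a <;> fin_cases b <;> fin_cases c <;> simp [cwConeWt, cwConeTensor, cwTensor]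

/-- … and its weight-`4` part is `T_{cw,2}` (the cube term has weight `6`). [new] -/
theorem cwConeTensor_initialPart (K : Type*) [CommSemiring K] :
    (fun a b c : Fin 3 => if cwConeWt a + cwConeWt b + cwConeWt c = 4 then cwConeTensor K a b c else 0) =
      cwTensor K 2 := by
  funext a b c
  fin_cases a <;> fin_cases b <;> fin_cases c <;> simp [cwConeWt, cwConeTensor, cwTensor]

/-- `e₀^{⊗3} + T_{cw,2} ⊵ T_{cw,2}` (toric: `x₀ ↦ ε² x₀`, `x_i ↦ ε x_i`). [new] -/
theorem cwConeTensor_algDegeneratesTo_cwTensor (K : Type*) [CommSemiring K] :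
    AlgDegeneratesTo (cwConeTensor K) (cwTensor K 2) := by
  have h := algDegeneratesTo_initialPart (cwConeTensor K) cwConeWt cwConeWt cwConeWt 4
    (cwConeTensor_low K)
  rwa [cwConeTensor_initialPart K] at h

/-- **`⟨2,2,2⟩ ⊵ T_{cw,2}`**: the little Coppersmith–Winograd tensor `T_{cw,2}` is a degeneration of the
`2 × 2` matrix multiplication tensor, i.e. it lies in the triangular tensor network variety with bond
dimensions `(2,2,2)`.  (It is not expected to be a restriction of it.) [new] -/
theorem matMulTensor_two_algDegeneratesTo_cwTensor_two :
    AlgDegeneratesTo (matMulTensor ℂ 2 2 2) (cwTensor ℂ 2) :=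
  matMulTensor_two_restrictsTo_cwConeTensor.algDegeneratesTo_trans
    (cwConeTensor_algDegeneratesTo_cwTensor ℂ)

/-- **`⟨2,2,2⟩ ⊵ X`** for the square-free monomial `X = xyz` (`≅ T_{cw,2}` over `ℂ`). [new] -/
theorem matMulTensor_two_algDegeneratesTo_xyzTensor :
    AlgDegeneratesTo (matMulTensor ℂ 2 2 2) (xyzTensor ℂ) :=
  matMulTensor_two_algDegeneratesTo_cwTensor_two.trans_restrictsTo tensorRestrictsTo_cwTensor_xyzTensor

/-- Kronecker powers: `⟨2,2,2⟩^{⊠N} ⊵ T_{cw,2}^{⊠N}` for every `N`. [new] -/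
theorem matMulTensor_two_pow_algDegeneratesTo_cwTensor_two_pow (N : ℕ) :
    AlgDegeneratesTo (kroneckerPow (matMulTensor ℂ 2 2 2) N) (kroneckerPow (cwTensor ℂ 2) N) :=
  matMulTensor_two_algDegeneratesTo_cwTensor_two.kroneckerPow N

end Summit.MatrixMultiplication.MatrixMultiplication.Theorems
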